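import Mathlib
import Summits.Ventures.PercRepro2.Defs
import Summits.Ventures.PercRepro2.Graph
import Summits.Ventures.PercRepro2.OneColourSwitch
import Summits.Ventures.PercRepro2.RegionHubSign
import Summits.Ventures.PercRepro2.SideSwitch
import Summits.Ventures.PercRepro2.M9NoPocketDefs
import Summits.Ventures.PercRepro2.M9NoPocketDeadMono

/-!
# Dead edges do not change the `Y`-connection of `p` and `q` (blind cell PercRepro2, p3 g35,
2026-08-29; `proofs/P3-NPHDR.md` §5′(b′))

A `Y`-path from `p` to `q` never passes through `d` when `p` is separated from the `Y`-world of
`{r, s}` and `d` lies in it (`conn_pq_avoid_d`); so turning edges at `d` from `Y` to `W` (a dead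
pattern) leaves `p ~_Y q` unchanged (`conn_pq_flipF_iff`), while it can only raise `p ~_W q`
(`sigma_mono` of `M9NoPocketDeadMono`).  This is the exactness half of step (b′): the dirty
point of a dead pattern has the `Y`-connection of its clean point and at least its
`W`-connection.  Own work; std axioms.
-/

namespace Summit.Ventures.PercRepro2

namespace NoPocket

open Finset Classical RegionHub OneColourSwitch SideSwitch

variable {V : Type*} {E : Type*}

section DeadY

variable {ends : E → Sym2 V}

/-- A `Y`-path from `p` to a vertex `y` avoids `d` and uses only edges not at `d`, as long as
`d` is in the `Y`-world of `{r, s}` and `p` is not: the `Y`-connection of `p` transfers to any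
colouring agreeing with `ω` off the edges at `d`. -/
lemma conn_of_conn_eqOn_off_d {ω ω' : Config E} {p r s d : V} (hpK : p ∉ K2 ends r s ω)
    (hdK : d ∈ K2 ends r s ω) (hagree : ∀ e, d ∉ ends e → ω e = ω' e) {y : V}
    (hc : Conn ends ω p y) : Conn ends ω' p y := by
  have hpd : p ≠ d := by
    rintro rfl
    exact hpK hdK
  have key : y ∈ {z | z ≠ d ∧ Conn ends ω p z ∧ Conn ends ω' p z} := by
    refine mem_of_conn_of_closed (ends := ends) (ω := ω) ?_ ⟨hpd, conn_refl _ _ _, conn_refl _ _ _⟩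
      hc
    rintro u ⟨hud, hu, hu'⟩ v hadj
    obtain ⟨_, e, he, hends⟩ := openGraph_adj.1 hadj
    have hv : Conn ends ω p v := conn_trans hu (conn_of_openAdj ⟨e, he, hends⟩)
    have hvd : v ≠ d := by
      rintro rfl
      -- then `p ~_Y d ~_Y r` (or `s`) in `ω`: `p` would be in the `Y`-world
      apply hpK
      rcases mem_K2_iff.1 hdK with h | h
      · exact mem_K2_iff.2 (Or.inl (conn_trans h (conn_symm hv)))
      · exact mem_K2_iff.2 (Or.inr (conn_trans h (conn_symm hv)))
    have hnd : d ∉ ends e := by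
      rw [hends]
      intro h
      rcases Sym2.mem_iff.1 h with h | h
      · exact hud h.symm
      · exact hvd h.symm
    have he' : ω' e = true := by rw [← hagree e hnd]; exact he
    exact ⟨hvd, hv, conn_trans hu' (conn_of_openAdj ⟨e, he', hends⟩)⟩
  exact key.2.2

/-- **Dead edges do not change `p ~_Y q`**: for a colouring `ω` with `d ∈ K₂` and `p ∉ K₂`,
any colouring agreeing with `ω` off the edges at `d` and with `d` still in its `Y`-world has the
same `Y`-connection of `p` and `q`. -/
lemma conn_pq_iff_of_eqOn_off_d {ω ω' : Config E} {p q r s d : V} (hpK : p ∉ K2 ends r s ω)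
    (hdK : d ∈ K2 ends r s ω) (hpK' : p ∉ K2 ends r s ω') (hdK' : d ∈ K2 ends r s ω')
    (hagree : ∀ e, d ∉ ends e → ω e = ω' e) :
    Conn ends ω' p q ↔ Conn ends ω p q :=
  ⟨conn_of_conn_eqOn_off_d hpK' hdK' (fun e he => (hagree e he).symm),
    conn_of_conn_eqOn_off_d hpK hdK hagree⟩

end DeadY

end NoPocket

end Summit.Ventures.PercRepro2
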